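import Literature.Geometry.Lorentzian.SubdevelopmentTimelikeEntry
import HarnessLib

/-!
# A globally hyperbolic subregion sharing the Cauchy hypersurface is causally convex
# (the causal lemma behind Sbierski 2016, §3.2, continued)

Sequel to `Literature.Geometry.Lorentzian.SubdevelopmentTimelikeEntry` (no timelike or causal entry
into `U` from `J⁺(S) ∖ U`). Here the time-dual statements are derived by reversing the time
orientation (achronality, Cauchy hypersurfaces of the sub-spacetime and the causal relations are
self-dual: `IsAchronal.reverse`, `IsCauchyHypersurface.reverse`, `TimeOrientation.restrict_reverse`),
and the two are combined into **causal convexity**: if `S` is a Cauchy hypersurface of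
`(M, g, τ)` (so that `M = J⁺(S) ∪ J⁻(S)`) and `S ∩ U` is a Cauchy hypersurface of the open
sub-spacetime `(U, g|_U, τ|_U)`, then every causal curve of `M` with both endpoints in `U` lies in
`U`; as sets, `J⁺(U) ∩ J⁻(U) ⊆ U`
(`LorentzianMetric.IsCauchyHypersurface.mem_opens_of_isFutureCausalCurveOn`,
`LorentzianMetric.IsCauchyHypersurface.causalFuture_inter_causalPast_subset_opens`).

For a common globally hyperbolic development `U ⊆ M` of two developments `M`, `M'` (J. Sbierski,
Ann. Henri Poincaré 17 (2016) = arXiv:1309.7591v3, Def. 2.4; `DevelopmentGluingData`) this is the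
tacit ingredient of §3.2: e.g. in the proof of Prop. 13 the identity
`ψ(I⁺(q, M) ∩ I⁻(p, M)) = I⁺(q', M') ∩ I⁻(p', M')` for `q ∈ U`, `p ∈ ∂U`, uses that the timelike
curves of `M` from `q` to points below `p ∈ closure U` do not leave `U`
(`CauchyDevelopment.CommonDevelopment.mem_opens_of_isFutureCausalCurveOn`,
`….causalFuture_inter_causalPast_subset_opens`). Ringström (2009, Ch. 23) works with the same
convexity when comparing two developments on their common domain.

Everything is proved; no definitions, no named facts (D-0026).

## References

* J. Sbierski, Ann. Henri Poincaré 17 (2016) 301–329 = arXiv:1309.7591v3, §3.2 (Prop. 13,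
  Lemmas 15–16; arXiv numbering). [Sbierski2016AHP]
* B. O'Neill, *Semi-Riemannian geometry with applications to relativity*, Academic Press 1983,
  Ch. 14, p. 402 (time duality), Cor. 14.1, Def. 14.28–Lemma 14.29. [ONeillSemiRiemannian1983]
* H. Ringström, *The Cauchy Problem in General Relativity*, EMS 2009, Ch. 23. [Ringstrom2009]
-/

noncomputable section

open Set Filter Function TopologicalSpace
open scoped Manifold ContDiff Topology

namespace Literature.Geometry.Lorentzian

universe u

variable {E : Type*} [NormedAddCommGroup E] [NormedSpace ℝ E] {H : Type*} [TopologicalSpace H]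
  {I : ModelWithCorners ℝ E H} {n : ℕ∞ω} {M : Type*} [TopologicalSpace M] [ChartedSpace H M]
  [IsManifold I ∞ M]

/-! ### Time duality bookkeeping -/

namespace TimeOrientation

variable {g : LorentzianMetric I n M} (τ : TimeOrientation g)

/-- Restriction facts for `τ` give restriction facts for `-τ` (negate the restricted sections).
O'Neill 1983, Ch. 14, p. 402 (time duality). [folklore] -/
theorem contMDiff_restrict_reverse (hτ : τ.contMDiff_restrict) : τ.reverse.contMDiff_restrict :=
  fun U ↦ (hτ U).neg_section

/-- **Restriction commutes with time reversal**: `(τ|_U)` reversed is `(-τ)|_U` (same vector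
field `x ↦ -T(x)`). O'Neill 1983, Ch. 14, p. 402. [folklore] -/
theorem restrict_reverse (hres : PseudoRiemannianMetric.contMDiff_restrict (I := I) (n := n) (M := M))
    (hτ : τ.contMDiff_restrict) (U : Opens M) :
    (τ.restrict hres hτ U).reverse = τ.reverse.restrict hres (τ.contMDiff_restrict_reverse hτ) U :=
  rfl

end TimeOrientation

namespace LorentzianMetric

variable {g : LorentzianMetric I n M} {τ : TimeOrientation g}

/-- **Achronality is self-dual**: `S` is achronal for `-τ` iff for `τ` (`q ∈ I⁻(p) ↔ p ∈ I⁺(q)`).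
O'Neill 1983, Ch. 14, p. 402 and p. 413. [cite: ONeillSemiRiemannian1983, Ch. 14, p. 413] -/
theorem IsAchronal.reverse {S : Set M} (hS : g.IsAchronal τ S) : g.IsAchronal τ.reverse S :=
  fun p hp q hq h ↦ hS q hq p hp (mem_chronologicalFuture_of_mem_chronologicalPast h)

/-! ### No timelike or causal exit from `U` into `J⁻(S) ∖ U` (time duals) -/

/-- **Time dual of `IsAchronal.mem_opens_of_mem_chronologicalFuture`**: with `S` achronal and
`S ∩ U` a Cauchy hypersurface of `(U, g|_U, τ|_U)`, if `r ∈ J⁻(S)`, `s ∈ U` and `s ≪ r`, then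
`r ∈ U` — apply the future statement to the reversed time orientation. Sbierski 2016, §3.2
("without loss of generality … otherwise we reverse the time orientation").
[cite: Sbierski2016AHP, §3.2, Lemma 15 and the remark after it (arXiv numbering)] -/
theorem IsAchronal.mem_opens_of_mem_causalPast_of_mem_chronologicalFuture [T2Space M]
    [SecondCountableTopology M] [BoundarylessManifold I M] [FiniteDimensional ℝ E] (hn : 2 ≤ n)
    (hres : PseudoRiemannianMetric.contMDiff_restrict (I := I) (n := n) (M := M))
    (hτ : τ.contMDiff_restrict) {S : Set M} (hS : g.IsAchronal τ S) {U : Opens M}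
    (hU : (g.restrict hres U).IsCauchyHypersurface (τ.restrict hres hτ U) (Subtype.val ⁻¹' S))
    {r s : M} (hr : r ∈ g.causalPast τ S) (hsU : s ∈ U)
    (hsr : r ∈ g.chronologicalFuture τ {s}) : r ∈ U := by
  have hU' : (g.restrict hres U).IsCauchyHypersurface
      (τ.reverse.restrict hres (τ.contMDiff_restrict_reverse hτ) U) (Subtype.val ⁻¹' S) := by
    rw [← TimeOrientation.restrict_reverse]
    exact hU.reverse
  exact hS.reverse.mem_opens_of_mem_chronologicalFuture hn hres (τ.contMDiff_restrict_reverse hτ)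
    hU' hr hsU (mem_chronologicalPast_of_mem_chronologicalFuture hsr)

/-- **Time dual of `IsAchronal.mem_opens_of_mem_causalFuture`**: if `r ∈ J⁻(S)`, `s ∈ U` and
`s ≤ r`, then `r ∈ U`. [cite: Sbierski2016AHP, §3.2, Lemma 15 and the remark after it (arXiv numbering)] -/
theorem IsAchronal.mem_opens_of_mem_causalPast_of_mem_causalFuture [T2Space M]
    [SecondCountableTopology M] [BoundarylessManifold I M] [FiniteDimensional ℝ E] (hn : 2 ≤ n)
    (hres : PseudoRiemannianMetric.contMDiff_restrict (I := I) (n := n) (M := M))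
    (hτ : τ.contMDiff_restrict) {S : Set M} (hS : g.IsAchronal τ S) {U : Opens M}
    (hU : (g.restrict hres U).IsCauchyHypersurface (τ.restrict hres hτ U) (Subtype.val ⁻¹' S))
    {r s : M} (hr : r ∈ g.causalPast τ S) (hsU : s ∈ U) (hsr : r ∈ g.causalFuture τ {s}) :
    r ∈ U := by
  have hU' : (g.restrict hres U).IsCauchyHypersurface
      (τ.reverse.restrict hres (τ.contMDiff_restrict_reverse hτ) U) (Subtype.val ⁻¹' S) := by
    rw [← TimeOrientation.restrict_reverse]
    exact hU.reverse
  exact hS.reverse.mem_opens_of_mem_causalFuture hn hres (τ.contMDiff_restrict_reverse hτ) hU' hr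
    hsU (mem_causalPast_singleton_iff.2 hsr)

/-! ### Causal convexity -/

/-- **A globally hyperbolic subregion sharing the Cauchy hypersurface is causally convex.** Let `S`
be a Cauchy hypersurface of `(M, g, τ)` and `U ⊆ M` open with `S ∩ U` a Cauchy hypersurface of
`(U, g|_U, τ|_U)`. Then a future causal curve `γ : [a, b] → M` with `γ a, γ b ∈ U` lies in `U`.
Indeed a point `w = γ t ∉ U` lies in `J⁺(S)` or in `J⁻(S)` (`M = I⁻(S) ⊔ S ⊔ I⁺(S)`, O'Neill's
Lemma 14.29); in the first case `w ≤ γ b ∈ U` is a causal entry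
(`IsAchronal.mem_opens_of_mem_causalFuture`), in the second `U ∋ γ a ≤ w` is a causal exit
(`IsAchronal.mem_opens_of_mem_causalPast_of_mem_causalFuture`), both impossible (`S` is achronal as
a Cauchy hypersurface). Used tacitly throughout Sbierski 2016, §3.2, e.g. for
`I⁺(q, M) ∩ I⁻(p, M) ⊆ U` in the proof of Prop. 13. [cite: Sbierski2016AHP, §3.2, proof of Prop. 13 (arXiv numbering)] -/
theorem IsCauchyHypersurface.mem_opens_of_isFutureCausalCurveOn [T2Space M]
    [SecondCountableTopology M] [BoundarylessManifold I M] [FiniteDimensional ℝ E] (hn : 2 ≤ n)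
    (hres : PseudoRiemannianMetric.contMDiff_restrict (I := I) (n := n) (M := M))
    (hτ : τ.contMDiff_restrict) {S : Set M} (hS : g.IsCauchyHypersurface τ S) {U : Opens M}
    (hU : (g.restrict hres U).IsCauchyHypersurface (τ.restrict hres hτ U) (Subtype.val ⁻¹' S))
    {γ : ℝ → M} {a b : ℝ} (hγ : g.IsFutureCausalCurveOn τ γ (Icc a b)) (ha : γ a ∈ U)
    (hb : γ b ∈ U) {t : ℝ} (ht : t ∈ Icc a b) : γ t ∈ U := by
  have hA : g.IsAchronal τ S := IsCauchyHypersurface.isAchronal_holds hn hS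
  by_contra hw
  -- `γ t ∈ J⁺(S) ∪ J⁻(S)`
  have hJ : γ t ∈ g.causalFuture τ S ∪ g.causalPast τ S := by
    by_cases hmem : γ t ∈ S
    · exact Or.inl (subset_causalFuture g τ S hmem)
    · rcases hS.mem_chronologicalFuture_union_chronologicalPast hn hmem with h | h
      · exact Or.inl (chronologicalFuture_subset_causalFuture g τ S h)
      · exact Or.inr (chronologicalFuture_subset_causalFuture g τ.reverse S h)
  rcases hJ with hJ | hJ
  · -- entry from `J⁺(S) ∖ U` into `γ b ∈ U`
    rcases eq_or_lt_of_le ht.2 with htb | htb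
    · exact hw (htb ▸ hb)
    · refine hw (hA.mem_opens_of_mem_causalFuture hn hres hτ hU hJ hb ?_)
      exact Or.inr ⟨γ t, rfl, γ, t, b, htb, hγ.mono (Icc_subset_Icc_left ht.1), rfl, rfl⟩
  · -- exit from `γ a ∈ U` into `J⁻(S) ∖ U`
    rcases eq_or_lt_of_le ht.1 with hat | hat
    · exact hw (hat ▸ ha)
    · refine hw (hA.mem_opens_of_mem_causalPast_of_mem_causalFuture hn hres hτ hU hJ ha ?_)
      exact Or.inr ⟨γ a, rfl, γ, a, t, hat, hγ.mono (Icc_subset_Icc_right ht.2), rfl, rfl⟩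

/-- **Set form of causal convexity: `J⁺(U) ∩ J⁻(U) ⊆ U`.** [cite: Sbierski2016AHP, §3.2, proof of Prop. 13 (arXiv numbering)] -/
theorem IsCauchyHypersurface.causalFuture_inter_causalPast_subset_opens [T2Space M]
    [SecondCountableTopology M] [BoundarylessManifold I M] [FiniteDimensional ℝ E] (hn : 2 ≤ n)
    (hres : PseudoRiemannianMetric.contMDiff_restrict (I := I) (n := n) (M := M))
    (hτ : τ.contMDiff_restrict) {S : Set M} (hS : g.IsCauchyHypersurface τ S) {U : Opens M}
    (hU : (g.restrict hres U).IsCauchyHypersurface (τ.restrict hres hτ U) (Subtype.val ⁻¹' S)) :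
    g.causalFuture τ (U : Set M) ∩ g.causalPast τ (U : Set M) ⊆ (U : Set M) := by
  rintro w ⟨hwF, hwP⟩
  have hA : g.IsAchronal τ S := IsCauchyHypersurface.isAchronal_holds hn hS
  -- `x ≤ w ≤ y` with `x, y ∈ U`
  rw [causalFuture_eq_biUnion] at hwF
  rw [causalPast, causalFuture_eq_biUnion] at hwP
  simp only [mem_iUnion, exists_prop] at hwF hwP
  obtain ⟨x, hxU, hxw⟩ := hwF
  obtain ⟨y, hyU, hwy⟩ := hwP
  have hwy' : y ∈ g.causalFuture τ {w} := mem_causalPast_singleton_iff.1 hwy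
  by_cases hmem : w ∈ S
  · exact hA.mem_opens_of_mem_causalFuture hn hres hτ hU (subset_causalFuture g τ S hmem) hyU hwy'
  · rcases hS.mem_chronologicalFuture_union_chronologicalPast hn hmem with h | h
    · exact hA.mem_opens_of_mem_causalFuture hn hres hτ hU
        (chronologicalFuture_subset_causalFuture g τ S h) hyU hwy'
    · exact hA.mem_opens_of_mem_causalPast_of_mem_causalFuture hn hres hτ hU
        (chronologicalFuture_subset_causalFuture g τ.reverse S h) hxU hxw

/-- **`I⁺(q) ∩ I⁻(p) ⊆ U` for `q ∈ U` and `p` in the closure of `U`** — the inclusion behind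
*"Moreover, we have `ψ(I⁺(q, M) ∩ I⁻(p, M)) = I⁺(q', M') ∩ I⁻(p', M')`"* in the proof of
Prop. 13 of Sbierski 2016, §3.2 (there `p ∈ ∂U`): if `q ≪ x ≪ p`, then `I⁺(x)` is an open
neighbourhood of `p`, so `x ≪ y` for some `y ∈ U`, and causal convexity gives `x ∈ U`.
[cite: Sbierski2016AHP, §3.2, proof of Prop. 13 (arXiv numbering)] -/
theorem IsCauchyHypersurface.chronologicalFuture_inter_chronologicalPast_subset_opens [T2Space M]
    [SecondCountableTopology M] [BoundarylessManifold I M] [FiniteDimensional ℝ E] (hn : 2 ≤ n)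
    (hres : PseudoRiemannianMetric.contMDiff_restrict (I := I) (n := n) (M := M))
    (hτ : τ.contMDiff_restrict) {S : Set M} (hS : g.IsCauchyHypersurface τ S) {U : Opens M}
    (hU : (g.restrict hres U).IsCauchyHypersurface (τ.restrict hres hτ U) (Subtype.val ⁻¹' S))
    {q p : M} (hq : q ∈ U) (hp : p ∈ closure (U : Set M)) :
    g.chronologicalFuture τ {q} ∩ g.chronologicalPast τ {p} ⊆ (U : Set M) := by
  rintro x ⟨hqx, hxp⟩
  have hpx : p ∈ g.chronologicalFuture τ {x} := mem_chronologicalFuture_of_mem_chronologicalPast hxp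
  obtain ⟨y, hyI, hyU⟩ : (g.chronologicalFuture τ {x} ∩ (U : Set M)).Nonempty :=
    mem_closure_iff.1 hp _ (isOpen_chronologicalFuture_of_boundaryless g τ {x}) hpx
  refine hS.causalFuture_inter_causalPast_subset_opens hn hres hτ hU ⟨?_, ?_⟩
  · exact causalFuture_mono (singleton_subset_iff.2 (show q ∈ (U : Set M) from hq))
      (chronologicalFuture_subset_causalFuture g τ {q} hqx)
  · refine causalFuture_mono (singleton_subset_iff.2 (show y ∈ (U : Set M) from hyU))
      (chronologicalFuture_subset_causalFuture g τ.reverse {y} ?_)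
    exact mem_chronologicalPast_of_mem_chronologicalFuture hyI

end LorentzianMetric

/-! ### The instances for common globally hyperbolic developments -/

namespace CauchyDevelopment.CommonDevelopment

variable {k : ℕ} {X : Type u} [TopologicalSpace X] [ChartedSpace (EuclideanSpace ℝ (Fin k)) X]
  [IsManifold (𝓡 k) ∞ X] [ConnectedSpace X] {D : InitialDataSet (𝓡 k) X}
  {𝒟 𝒟' : CauchyDevelopment D}

/-- **A common globally hyperbolic development is causally convex in `M`**: a future causal curve
of the Cauchy development `𝒟` with both endpoints in the common development `U` stays in `U`
(Sbierski 2016, Def. 2.4 and §3.2). [cite: Sbierski2016AHP, §3.2, proof of Prop. 13 (arXiv numbering)] -/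
theorem mem_opens_of_isFutureCausalCurveOn (𝔠 : CommonDevelopment 𝒟 𝒟') {γ : ℝ → 𝒟.carrier}
    {a b : ℝ} (hγ : 𝒟.metric.IsFutureCausalCurveOn 𝒟.timeOrientation γ (Icc a b))
    (ha : γ a ∈ 𝔠.opens) (hb : γ b ∈ 𝔠.opens) {t : ℝ} (ht : t ∈ Icc a b) : γ t ∈ 𝔠.opens :=
  𝒟.isCauchyHypersurface.mem_opens_of_isFutureCausalCurveOn (WithTop.coe_le_coe.mpr le_top) _ _
    𝔠.isCauchyHypersurface hγ ha hb ht

/-- **`J⁺(U) ∩ J⁻(U) ⊆ U`** for a common globally hyperbolic development `U` of `𝒟` and `𝒟'`.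
[cite: Sbierski2016AHP, §3.2, proof of Prop. 13 (arXiv numbering)] -/
theorem causalFuture_inter_causalPast_subset_opens (𝔠 : CommonDevelopment 𝒟 𝒟') :
    𝒟.metric.causalFuture 𝒟.timeOrientation (𝔠.opens : Set 𝒟.carrier) ∩
        𝒟.metric.causalPast 𝒟.timeOrientation (𝔠.opens : Set 𝒟.carrier) ⊆ 𝔠.opens :=
  𝒟.isCauchyHypersurface.causalFuture_inter_causalPast_subset_opens (WithTop.coe_le_coe.mpr le_top)
    _ _ 𝔠.isCauchyHypersurface

/-- **`I⁺(q) ∩ I⁻(p) ⊆ U`** for `q ∈ U` and `p ∈ closure U`, `U` a common globally hyperbolic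
development (Sbierski 2016, §3.2, proof of Prop. 13). [cite: Sbierski2016AHP, §3.2, proof of Prop. 13 (arXiv numbering)] -/
theorem chronologicalFuture_inter_chronologicalPast_subset_opens (𝔠 : CommonDevelopment 𝒟 𝒟')
    {q p : 𝒟.carrier} (hq : q ∈ 𝔠.opens) (hp : p ∈ closure (𝔠.opens : Set 𝒟.carrier)) :
    𝒟.metric.chronologicalFuture 𝒟.timeOrientation {q} ∩
        𝒟.metric.chronologicalPast 𝒟.timeOrientation {p} ⊆ 𝔠.opens :=
  𝒟.isCauchyHypersurface.chronologicalFuture_inter_chronologicalPast_subset_opens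
    (WithTop.coe_le_coe.mpr le_top) _ _ 𝔠.isCauchyHypersurface hq hp

end CauchyDevelopment.CommonDevelopment

end Literature.Geometry.Lorentzian

end
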